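import Summits.MatrixMultiplication.MatrixMultiplication.Theorems.SoloInformedTwistedSliceRank
import Mathlib.LinearAlgebra.Dimension.OrzechProperty
import Mathlib.LinearAlgebra.Dimension.Constructions
import Mathlib.Algebra.CharP.Lemmas
import Mathlib.Algebra.CharP.Algebra
import Mathlib.Algebra.MonoidAlgebra.Basic
import Mathlib.Data.ZMod.Basic
import HarnessLib

/-!
# Augmentation coordinates of `K[∏ ℤ/p^{e_i}]`: the monomial basis is filtered for EVERY endomorphism

Solo-informed seat (MatrixMultiplication), gen 102; sequel of `SoloInformedTwistedSliceRank`
(Theorem B‴ of the seat's dossier, sharpest-statement §2y(8)). For a finite abelian `p`-group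
`G = ∏_i ℤ/n_i`, `n_i = p^{e_i}`, written multiplicatively, and a field `K` of characteristic `p`,
the monomials `β_k = ∏_i (x_i - 1)^{k_i}` (`0 ≤ k_i < n_i`, `x_i` the `i`-th coordinate generator)
form a basis of `K[G]` with `β_k β_l = β_{k+l}` or `0` ((`x_i - 1)^{n_i} = x_i^{n_i} - 1 = 0`), so
with the PLAIN degree `deg k = Σ_i k_i` they are graded coordinates in the sense of
`GradedCoords` (BCCGU 2017, Prop. 3.2/3.10), and the filtration
`I_d = span{β_k : deg k ≥ d}` is the `d`-th power of the augmentation ideal — hence stable under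
the algebra endomorphism `φ_*` of `K[G]` induced by ANY group endomorphism `φ`
(`exists_augCoords`: the `β_j`-coordinate of `φ_*(β_{j'})` vanishes for `deg j < deg j'`).
This is the input that makes the twisted codimension bound `card_le_of_twistedMatching` give,
for twisted matchings under arbitrary automorphism twists, EXACTLY the untwisted count
`#{deg < a} + #{deg < b} + #{deg ≥ a+b}` of Blasiak–Church–Cohn–Grochow–Naslund–Sawin–Umans 2017,
Thm. 4.14 (there via the Lucas-binomial basis of functions, Prop. 4.15; the monomial basis of the
group algebra is the dual picture) — in place of the level-weighted count of the seat's
`SoloInformedTwistedMatchingsAbelian` (weights `(p+1)^{level}`), which is not sharp for `e_i ≥ 2`.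

No definitions: the coordinates `u_i = x_i - 1` and the monomials `β` enter the lemmas as
variables with defining hypotheses (`hu`, `hβ`), and the graded coordinates are packaged
existentially in `exists_augCoords`.

References: BlasiakChurchCohnGrochowUmans2017 (arXiv:1712.02302) Prop. 3.2, Prop. 3.10, Lemma 3.3;
BlasiakChurchCohnGrochowNaslundSawinUmans2017 (arXiv:1605.06702) Prop. 4.15, Thm. 4.14;
S. A. Jennings, Trans. AMS 50 (1941); CohnUmans2013 (arXiv:1207.6528) §5, Conj. 21.
-/

noncomputable section

open scoped BigOperators
open Finset Literature.Combinatorics.Additive Literature.Barriers.MatrixMultiplication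

namespace Summit.MatrixMultiplication.MatrixMultiplication.Theorems.TwistedSliceRank

section AugCoords

variable {K : Type*} [Field K] {κ : Type} [Fintype κ] [DecidableEq κ] {n : κ → ℕ}
  [∀ i, NeZero (n i)]
  (u : κ → MonoidAlgebra K ((i : κ) → Multiplicative (ZMod (n i))))
  (hu : ∀ i, u i = MonoidAlgebra.of K _ (Pi.mulSingle i (Multiplicative.ofAdd 1)) - 1)
  (β : ((i : κ) → Fin (n i)) → MonoidAlgebra K ((i : κ) → Multiplicative (ZMod (n i))))
  (hβ : ∀ k, β k = ∏ i, u i ^ (k i : ℕ))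

/-! ### Expansion of group elements in the monomials -/

include hu in
/-- `x = ∏_i (u_i + 1)^{a_i}` for `x = (a_i)_i`. [folklore] -/
theorem of_eq_prod_pow (g : (i : κ) → Multiplicative (ZMod (n i))) :
    MonoidAlgebra.of K _ g = ∏ i, (u i + 1) ^ (ZMod.val (Multiplicative.toAdd (g i))) := by
  conv_lhs => rw [← Finset.univ_prod_mulSingle g, map_prod]
  refine Finset.prod_congr rfl fun i _ => ?_
  rw [hu i, sub_add_cancel, ← map_pow, ← Pi.mulSingle_pow, ← ofAdd_nsmul, nsmul_eq_mul, mul_one,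
    ZMod.natCast_zmod_val, ofAdd_toAdd]

/-- Binomial expansion cut at `n`: for `a < n`, `(u+1)^a = Σ_{m<n} u^m · C(a,m)`. [folklore] -/
theorem add_one_pow_eq_sum_fin {A : Type*} [CommRing A] (v : A) {a N : ℕ} (ha : a < N) :
    (v + 1) ^ a = ∑ m : Fin N, v ^ (m : ℕ) * ((a.choose m : ℕ) : A) := by
  rw [add_pow, Fin.sum_univ_eq_sum_range (fun m => v ^ m * ((a.choose m : ℕ) : A)) N]
  simp only [one_pow, mul_one]
  refine Finset.sum_subset (fun m hm => ?_) (fun m _ hm => ?_)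
  · simp only [Finset.mem_range] at hm ⊢; omega
  · simp only [Finset.mem_range, not_lt] at hm
    rw [Nat.choose_eq_zero_of_lt (by omega), Nat.cast_zero, mul_zero]

include hu hβ in
/-- Every group element is an `ℕ`-combination of the monomials:
`x = Σ_k (∏_i C(a_i, k_i)) · β_k`. [folklore] -/
theorem of_eq_sum_monomials (g : (i : κ) → Multiplicative (ZMod (n i))) :
    MonoidAlgebra.of K _ g = ∑ k : (i : κ) → Fin (n i),
      ((∏ i, (ZMod.val (Multiplicative.toAdd (g i))).choose (k i) : ℕ) : MonoidAlgebra K _) *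
        β k := by
  rw [of_eq_prod_pow u hu g]
  have h1 : ∀ i, (u i + 1) ^ (ZMod.val (Multiplicative.toAdd (g i))) =
      ∑ m : Fin (n i), u i ^ (m : ℕ) *
        (((ZMod.val (Multiplicative.toAdd (g i))).choose m : ℕ) : MonoidAlgebra K _) :=
    fun i => add_one_pow_eq_sum_fin (u i) (ZMod.val_lt _)
  simp_rw [h1]
  rw [Fintype.prod_sum]
  refine Finset.sum_congr rfl fun k _ => ?_
  rw [Finset.prod_mul_distrib, hβ k, Nat.cast_prod, mul_comm]

include hu hβ in
/-- The monomials span `K[G]`. [folklore] -/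
theorem span_monomials_eq_top : Submodule.span K (Set.range β) = ⊤ := by
  refine Submodule.eq_top_iff'.2 fun f => ?_
  induction f using MonoidAlgebra.induction_on with
  | hM g =>
    rw [of_eq_sum_monomials u hu β hβ g]
    refine Submodule.sum_mem _ fun k _ => ?_
    rw [← nsmul_eq_mul]
    exact nsmul_mem (Submodule.subset_span (Set.mem_range_self k)) _
  | hadd f g hf hg => exact Submodule.add_mem _ hf hg
  | hsmul r f hf => exact Submodule.smul_mem _ r hf

/-- `#{monomials} = dim K[G]`. [folklore] -/
theorem card_exponents_eq_finrank :
    Fintype.card ((i : κ) → Fin (n i)) =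
      Module.finrank K (MonoidAlgebra K ((i : κ) → Multiplicative (ZMod (n i)))) := by
  rw [Module.finrank_eq_card_basis
    (MonoidAlgebra.basis ((i : κ) → Multiplicative (ZMod (n i))) K), Fintype.card_pi,
    Fintype.card_pi]
  simp [ZMod.card]

/-! ### Products of monomials -/

omit [DecidableEq κ] [∀ i, NeZero (n i)] in
include hβ in
/-- `β_k β_l = ∏ u_i^{k_i + l_i}`. [folklore] -/
theorem monomial_mul (k l : (i : κ) → Fin (n i)) :
    β k * β l = ∏ i, u i ^ ((k i : ℕ) + l i) := by
  rw [hβ, hβ, ← Finset.prod_mul_distrib]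
  exact Finset.prod_congr rfl fun i _ => (pow_add _ _ _).symm

variable {p : ℕ} [hp : Fact p.Prime] [CharP K p] {e : κ → ℕ}

omit [Fintype κ] [∀ i, NeZero (n i)] in
include hu in
/-- `u_i^{n_i} = x_i^{n_i} - 1 = 0` (`n_i = p^{e_i}`, characteristic `p`). [folklore] -/
theorem u_pow_card_eq_zero (hn : ∀ i, n i = p ^ e i) (i : κ) : u i ^ n i = 0 := by
  haveI : CharP (MonoidAlgebra K ((i : κ) → Multiplicative (ZMod (n i)))) p := by
    have h : Function.Injective
        (algebraMap K (MonoidAlgebra K ((i : κ) → Multiplicative (ZMod (n i))))) := by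
      rw [MonoidAlgebra.coe_algebraMap]
      exact MonoidAlgebra.single_right_injective.comp (algebraMap K K).injective
    exact charP_of_injective_algebraMap h p
  have key : u i ^ (p ^ e i) = 0 := by
    rw [hu i, sub_pow_char_pow_of_commute p (e i) (Commute.one_right _), one_pow, ← map_pow,
      ← Pi.mulSingle_pow, ← ofAdd_nsmul, nsmul_eq_mul, mul_one, ← hn i, ZMod.natCast_self,
      ofAdd_zero, Pi.mulSingle_one,
      map_one (MonoidAlgebra.of K ((i : κ) → Multiplicative (ZMod (n i)))), sub_self]
  rw [hn i]
  exact key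

omit [∀ i, NeZero (n i)] in
include hu in
/-- A product `∏ u_i^{m_i}` with some `m_i ≥ n_i` vanishes. [folklore] -/
theorem prod_pow_eq_zero (hn : ∀ i, n i = p ^ e i) {m : κ → ℕ} {i : κ} (hi : n i ≤ m i) :
    ∏ j, u j ^ m j = 0 := by
  refine Finset.prod_eq_zero (Finset.mem_univ i) ?_
  rw [← Nat.sub_add_cancel hi, pow_add, u_pow_card_eq_zero u hu hn i, mul_zero]

omit [∀ i, NeZero (n i)] in
include hu hβ in
/-- The monomials are graded for the plain degree `deg k = Σ k_i`: `β_k β_l` is `β_{k+l}` (degree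
`deg k + deg l`) or `0`. [folklore] -/
theorem monomial_mul_mem_span (hn : ∀ i, n i = p ^ e i) (k l : (i : κ) → Fin (n i)) :
    β k * β l ∈ Submodule.span K
      (β '' {m : (i : κ) → Fin (n i) | ∑ i, (k i : ℕ) + ∑ i, (l i : ℕ) ≤ ∑ i, (m i : ℕ)}) := by
  rw [monomial_mul u β hβ]
  by_cases h : ∀ i, (k i : ℕ) + l i < n i
  · refine Submodule.subset_span ⟨fun i => ⟨(k i : ℕ) + l i, h i⟩, ?_, ?_⟩
    · show _ ≤ ∑ i, ((k i : ℕ) + l i)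
      rw [Finset.sum_add_distrib]
    · rw [hβ]
  · push Not at h
    obtain ⟨i, hi⟩ := h
    rw [prod_pow_eq_zero u hu hn (m := fun j => (k j : ℕ) + l j) hi]
    exact Submodule.zero_mem _

/-! ### The filtration `I_d = span{β_k : deg k ≥ d}` -/

include hu hβ in
/-- `I_0 = K[G]`. [folklore] -/
theorem span_deg_ge_zero_eq_top :
    Submodule.span K (β '' {m : (i : κ) → Fin (n i) | 0 ≤ ∑ i, (m i : ℕ)}) = ⊤ := by
  rw [← span_monomials_eq_top u hu β hβ]
  congr 1
  ext f
  simp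

omit [∀ i, NeZero (n i)] in
include hu hβ in
/-- `I_a · I_b ⊆ I_{a+b}`. [folklore] -/
theorem span_deg_ge_mul_le (hn : ∀ i, n i = p ^ e i) (a b : ℕ) :
    Submodule.span K (β '' {m : (i : κ) → Fin (n i) | a ≤ ∑ i, (m i : ℕ)}) *
        Submodule.span K (β '' {m : (i : κ) → Fin (n i) | b ≤ ∑ i, (m i : ℕ)}) ≤
      Submodule.span K (β '' {m : (i : κ) → Fin (n i) | a + b ≤ ∑ i, (m i : ℕ)}) := by
  rw [Submodule.span_mul_span]
  refine Submodule.span_le.2 ?_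
  rintro _ ⟨_, ⟨k, hk, rfl⟩, _, ⟨l, hl, rfl⟩, rfl⟩
  simp only [Set.mem_setOf_eq] at hk hl
  refine Submodule.span_mono ?_ (monomial_mul_mem_span u hu β hβ hn k l)
  refine Set.image_mono fun m hm => ?_
  simp only [Set.mem_setOf_eq] at hm ⊢
  omega

include hu hβ in
/-- A product `∏_{i ∈ s} y_i^{m_i}` of elements `y_i ∈ I_1` lies in `I_{Σ m_i}`. [folklore] -/
theorem prod_pow_mem_span_deg_ge (hn : ∀ i, n i = p ^ e i) {α : Type*} (s : Finset α)
    (y : α → MonoidAlgebra K ((i : κ) → Multiplicative (ZMod (n i)))) (m : α → ℕ)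
    (hy : ∀ a ∈ s, y a ∈ Submodule.span K (β '' {k : (i : κ) → Fin (n i) | 1 ≤ ∑ i, (k i : ℕ)})) :
    ∏ a ∈ s, y a ^ m a ∈
      Submodule.span K (β '' {k : (i : κ) → Fin (n i) | ∑ a ∈ s, m a ≤ ∑ i, (k i : ℕ)}) := by
  classical
  -- powers first
  have hpow : ∀ (x : MonoidAlgebra K ((i : κ) → Multiplicative (ZMod (n i)))) (t : ℕ),
      x ∈ Submodule.span K (β '' {k : (i : κ) → Fin (n i) | 1 ≤ ∑ i, (k i : ℕ)}) →
      x ^ t ∈ Submodule.span K (β '' {k : (i : κ) → Fin (n i) | t ≤ ∑ i, (k i : ℕ)}) := by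
    intro x t hx
    induction t with
    | zero => rw [pow_zero, span_deg_ge_zero_eq_top u hu β hβ]; exact Submodule.mem_top
    | succ t ih =>
      rw [pow_succ]
      exact span_deg_ge_mul_le u hu β hβ hn t 1 (Submodule.mul_mem_mul ih hx)
  induction s using Finset.cons_induction with
  | empty =>
    rw [Finset.prod_empty, Finset.sum_empty, span_deg_ge_zero_eq_top u hu β hβ]
    exact Submodule.mem_top
  | cons a s ha ih =>
    rw [Finset.prod_cons, Finset.sum_cons]
    exact span_deg_ge_mul_le u hu β hβ hn (m a) (∑ a ∈ s, m a)
      (Submodule.mul_mem_mul (hpow _ _ (hy a (Finset.mem_cons.2 (Or.inl rfl))))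
        (ih fun b hb => hy b (Finset.mem_cons.2 (Or.inr hb))))

/-! ### The augmentation and `x - 1 ∈ I_1` -/

omit [∀ i, NeZero (n i)] in
include hu hβ in
/-- The augmentation kills the monomials of positive degree. [folklore] -/
theorem aug_monomial_eq_zero {m : (i : κ) → Fin (n i)} (hm : 1 ≤ ∑ i, (m i : ℕ)) :
    MonoidAlgebra.lift K K _ (1 : ((i : κ) → Multiplicative (ZMod (n i))) →* K) (β m) = 0 := by
  have h : ∃ i, (m i : ℕ) ≠ 0 := by
    by_contra hcon
    push Not at hcon
    have : ∑ i, (m i : ℕ) = 0 := Finset.sum_eq_zero fun i _ => hcon i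
    omega
  obtain ⟨i, hi⟩ := h
  rw [hβ, map_prod]
  refine Finset.prod_eq_zero (Finset.mem_univ i) ?_
  rw [map_pow, hu i, map_sub, MonoidAlgebra.lift_of, MonoidHom.one_apply,
    map_one (MonoidAlgebra.lift K K ((i : κ) → Multiplicative (ZMod (n i)))
      (1 : ((i : κ) → Multiplicative (ZMod (n i))) →* K)), sub_self, zero_pow hi]

omit [∀ i, NeZero (n i)] in
include hu hβ in
/-- The augmentation kills `I_1`. [folklore] -/
theorem aug_eq_zero_of_mem_span_deg_ge_one {f : MonoidAlgebra K ((i : κ) → Multiplicative (ZMod (n i)))}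
    (hf : f ∈ Submodule.span K (β '' {k : (i : κ) → Fin (n i) | 1 ≤ ∑ i, (k i : ℕ)})) :
    MonoidAlgebra.lift K K _ (1 : ((i : κ) → Multiplicative (ZMod (n i))) →* K) f = 0 := by
  induction hf using Submodule.span_induction with
  | mem y hy =>
    obtain ⟨m, hm, rfl⟩ := hy
    exact aug_monomial_eq_zero u hu β hβ hm
  | zero => simp
  | add y z _ _ hy hz => rw [map_add, hy, hz, add_zero]
  | smul r y _ hy => rw [map_smul, hy, smul_zero]

include hu hβ in
/-- `x - 1 ∈ I_1` for every group element `x` (the augmentation ideal is `I_1`). [folklore] -/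
theorem of_sub_one_mem_span_deg_ge_one (g : (i : κ) → Multiplicative (ZMod (n i))) :
    MonoidAlgebra.of K _ g - 1 ∈
      Submodule.span K (β '' {k : (i : κ) → Fin (n i) | 1 ≤ ∑ i, (k i : ℕ)}) := by
  set I1 := Submodule.span K (β '' {k : (i : κ) → Fin (n i) | 1 ≤ ∑ i, (k i : ℕ)}) with hI1
  have hle : (⊤ : Submodule K (MonoidAlgebra K ((i : κ) → Multiplicative (ZMod (n i))))) ≤
      (K ∙ (1 : MonoidAlgebra K _)) ⊔ I1 := by
    rw [← span_monomials_eq_top u hu β hβ]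
    refine Submodule.span_le.2 ?_
    rintro _ ⟨m, rfl⟩
    by_cases hm : 1 ≤ ∑ i, (m i : ℕ)
    · exact Submodule.mem_sup_right (Submodule.subset_span ⟨m, hm, rfl⟩)
    · refine Submodule.mem_sup_left ?_
      have h0 : ∀ i, (m i : ℕ) = 0 := fun i =>
        (Finset.sum_eq_zero_iff.1 (by omega : ∑ j, (m j : ℕ) = 0)) i (Finset.mem_univ i)
      have hβm : β m = 1 := by
        rw [hβ]
        exact Finset.prod_eq_one fun i _ => by rw [h0 i, pow_zero]
      rw [hβm]
      exact Submodule.mem_span_singleton_self _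
  have hf : MonoidAlgebra.of K _ g - 1 ∈ (K ∙ (1 : MonoidAlgebra K _)) ⊔ I1 :=
    hle Submodule.mem_top
  obtain ⟨y, hy, z, hz, hyz⟩ := Submodule.mem_sup.1 hf
  obtain ⟨c, rfl⟩ := Submodule.mem_span_singleton.1 hy
  have hc : c = 0 := by
    have e1 : MonoidAlgebra.lift K K _ (1 : ((i : κ) → Multiplicative (ZMod (n i))) →* K)
        (1 : MonoidAlgebra K _) = 1 :=
      map_one (MonoidAlgebra.lift K K ((i : κ) → Multiplicative (ZMod (n i)))
        (1 : ((i : κ) → Multiplicative (ZMod (n i))) →* K))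
    have e2 : MonoidAlgebra.lift K K _ (1 : ((i : κ) → Multiplicative (ZMod (n i))) →* K)
        (MonoidAlgebra.of K _ g) = 1 := by
      rw [MonoidAlgebra.lift_of, MonoidHom.one_apply]
    have h := congr_arg
      (MonoidAlgebra.lift K K _ (1 : ((i : κ) → Multiplicative (ZMod (n i))) →* K)) hyz
    rw [map_add, aug_eq_zero_of_mem_span_deg_ge_one u hu β hβ hz, add_zero, map_smul, e1, map_sub,
      e2, e1, sub_self, smul_eq_mul, mul_one] at h
    exact h
  rw [hc, zero_smul, zero_add] at hyz
  rw [← hyz]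
  exact hz

/-! ### Push-forward along a group endomorphism -/

include hu hβ in
/-- **`φ_*(β_m) ∈ I_{deg m}` for every group endomorphism `φ`**: the push-forward is an algebra map,
`φ_*(u_i) = φ(x_i) - 1 ∈ I_1`, and `I_1^d ⊆ I_d`. [folklore] -/
theorem mapDomain_monomial_mem_span_deg_ge (hn : ∀ i, n i = p ^ e i)
    (φ : ((i : κ) → Multiplicative (ZMod (n i))) →* ((i : κ) → Multiplicative (ZMod (n i))))
    (m : (i : κ) → Fin (n i)) :
    MonoidAlgebra.mapDomainAlgHom K K φ (β m) ∈
      Submodule.span K (β '' {k : (i : κ) → Fin (n i) | ∑ i, (m i : ℕ) ≤ ∑ i, (k i : ℕ)}) := by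
  rw [hβ, map_prod]
  simp_rw [map_pow]
  refine prod_pow_mem_span_deg_ge u hu β hβ hn Finset.univ
    (fun i => MonoidAlgebra.mapDomainAlgHom K K φ (u i)) (fun i => (m i : ℕ)) fun i _ => ?_
  have hof : MonoidAlgebra.mapDomainAlgHom K K φ
      (MonoidAlgebra.of K _ (Pi.mulSingle i (Multiplicative.ofAdd (1 : ZMod (n i))))) =
      MonoidAlgebra.of K _ (φ (Pi.mulSingle i (Multiplicative.ofAdd (1 : ZMod (n i))))) := by
    simp [MonoidAlgebra.of_apply, MonoidAlgebra.mapDomain_single]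
  rw [hu i, map_sub, map_one (MonoidAlgebra.mapDomainAlgHom K K φ), hof]
  exact of_sub_one_mem_span_deg_ge_one u hu β hβ _

/-! ### Packaging: graded coordinates filtered for every endomorphism -/

/-- **Augmentation coordinates.** For `G = ∏_i ℤ/p^{e_i}` and `char K = p` there are graded
coordinates on `K[G]` indexed by the exponent vectors `k ∈ ∏_i [0, p^{e_i})` with the PLAIN degree
`deg k = Σ_i k_i` (the monomial basis `∏ (x_i - 1)^{k_i}` adapted to the powers of the augmentation
ideal), for which the push-forward along EVERY group endomorphism `φ` is filtered: the
`β_j`-coordinate of `φ_*(β_{j'})` vanishes whenever `deg j < deg j'`. [this work] -/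
theorem exists_augCoords (p : ℕ) [Fact p.Prime] (K : Type*) [Field K] [CharP K p]
    {κ : Type} [Fintype κ] [DecidableEq κ] (n e : κ → ℕ) [∀ i, NeZero (n i)]
    (hn : ∀ i, n i = p ^ e i) :
    ∃ B : GradedCoords K ((i : κ) → Multiplicative (ZMod (n i))) ((i : κ) → Fin (n i)),
      (∀ k, B.deg k = ∑ i, (k i : ℕ)) ∧
      ∀ (φ : ((i : κ) → Multiplicative (ZMod (n i))) →* ((i : κ) → Multiplicative (ZMod (n i))))
        (j' j : (i : κ) → Fin (n i)), B.deg j < B.deg j' →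
        ∑ x', B.P j' x' * B.Q (φ x') j = 0 := by
  classical
  set u : κ → MonoidAlgebra K ((i : κ) → Multiplicative (ZMod (n i))) :=
    fun i => MonoidAlgebra.of K _ (Pi.mulSingle i (Multiplicative.ofAdd 1)) - 1 with hu'
  have hu : ∀ i, u i = MonoidAlgebra.of K _ (Pi.mulSingle i (Multiplicative.ofAdd 1)) - 1 :=
    fun i => rfl
  set β : ((i : κ) → Fin (n i)) → MonoidAlgebra K ((i : κ) → Multiplicative (ZMod (n i))) :=
    fun k => ∏ i, u i ^ (k i : ℕ) with hβ'
  have hβ : ∀ k, β k = ∏ i, u i ^ (k i : ℕ) := fun k => rfl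
  -- the basis
  let Bβ : Module.Basis ((i : κ) → Fin (n i)) K
      (MonoidAlgebra K ((i : κ) → Multiplicative (ZMod (n i)))) :=
    basisOfTopLeSpanOfCardEqFinrank β (span_monomials_eq_top u hu β hβ).ge
      card_exponents_eq_finrank
  have hBβ : ∀ k, Bβ k = β k := fun k => by
    simp only [Bβ, coe_basisOfTopLeSpanOfCardEqFinrank]
  have hmul : ∀ k l, Bβ k * Bβ l ∈ Submodule.span K
      (Bβ '' {m : (i : κ) → Fin (n i) | ∑ i, (k i : ℕ) + ∑ i, (l i : ℕ) ≤ ∑ i, (m i : ℕ)}) := by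
    intro k l
    have hcoe : (Bβ : ((i : κ) → Fin (n i)) → MonoidAlgebra K _) = β := funext hBβ
    rw [hcoe]
    exact monomial_mul_mem_span u hu β hβ hn k l
  refine ⟨GradedCoords.ofBasis Bβ (fun k => ∑ i, (k i : ℕ)) hmul, fun k => rfl, ?_⟩
  intro φ j' j hlt
  simp only [GradedCoords.ofBasis_deg] at hlt
  -- the sum is the `j`-th coordinate of `φ_*(β_{j'})`
  show ∑ x', (Bβ j').coeff x' * Bβ.repr (MonoidAlgebra.of K _ (φ x')) j = 0
  have hexp : ∀ f : MonoidAlgebra K ((i : κ) → Multiplicative (ZMod (n i))),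
      f = ∑ x, f.coeff x • MonoidAlgebra.of K _ x := fun f => by
    apply MonoidAlgebra.coeff_injective
    rw [MonoidAlgebra.coeff_sum]
    conv_lhs => rw [← Finsupp.univ_sum_single f.coeff]
    refine Finset.sum_congr rfl fun x _ => ?_
    rw [MonoidAlgebra.coeff_smul, MonoidAlgebra.of_apply, MonoidAlgebra.coeff_single,
      Finsupp.smul_single_one]
  have hΦ : MonoidAlgebra.mapDomainAlgHom K K φ (Bβ j') =
      ∑ x, (Bβ j').coeff x • MonoidAlgebra.of K _ (φ x) := by
    conv_lhs => rw [hexp (Bβ j')]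
    rw [map_sum]
    refine Finset.sum_congr rfl fun x _ => ?_
    rw [map_smul]
    congr 1
    simp [MonoidAlgebra.of_apply, MonoidAlgebra.mapDomain_single]
  have hcoord : Bβ.repr (MonoidAlgebra.mapDomainAlgHom K K φ (Bβ j')) j =
      ∑ x, (Bβ j').coeff x * Bβ.repr (MonoidAlgebra.of K _ (φ x)) j := by
    rw [hΦ, map_sum, Finsupp.coe_finsetSum, Finset.sum_apply]
    refine Finset.sum_congr rfl fun x _ => ?_
    rw [map_smul, Finsupp.smul_apply, smul_eq_mul]
  rw [← hcoord]
  have hmem : MonoidAlgebra.mapDomainAlgHom K K φ (Bβ j') ∈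
      Submodule.span K (Bβ '' {k : (i : κ) → Fin (n i) | ∑ i, (j' i : ℕ) ≤ ∑ i, (k i : ℕ)}) := by
    have hcoe : (Bβ : ((i : κ) → Fin (n i)) → MonoidAlgebra K _) = β := funext hBβ
    rw [hcoe]
    exact mapDomain_monomial_mem_span_deg_ge u hu β hβ hn φ j'
  have hsub := Bβ.repr_support_subset_of_mem_span _ hmem
  by_contra hne
  have hj := hsub (Finsupp.mem_support_iff.2 hne)
  simp only [Set.mem_setOf_eq] at hj
  omega

end AugCoords

end Summit.MatrixMultiplication.MatrixMultiplication.Theorems.TwistedSliceRank
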